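import Mathlib
import Summits.CriticalPhenomena.PercolationContinuityZ3.Theorems.PercNearOneGluingNoHeavyLowerTailOrientedAntipodalHallAssignment
import Summits.CriticalPhenomena.PercolationContinuityZ3.Theorems.PercNearOneGluingNoHeavyLowerTailThreeFamilyOrderedMiddle

/-!
# The oriented antipodal Hall count from a three-group assignment with an ORDERED MIDDLE GROUP

Helper file for crux `stmt-CriticalPhenomena-4575` (`NoHeavyLowerTail`, route `PercNearOneGluingNoHeavy`),
new-inequality factory seat `prim-ineq-gen-3` (gen 11).  Everything here is PROVED.

`OrientedAntipodalHall.card_le_card_goods_above_of_assignment` (gen 10) sorts the antipodal bads of a monotone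
`f : Finset α → Lab k` into three groups `D₁, D₂, D₃` with complementation bits `cpl` and oriented labels `a, b`, and asks
WITHIN EACH GROUP for equal bits.  For the MIDDLE group `D₂` this is unnecessary: complemented and plain classes may be
mixed, provided (besides `a X ≠ b X'`, `b X ≠ a X'`) a complemented `X` and a plain `X'` never carry the same oriented labels
(`¬ (a X = a X' ∧ b X = b X')` — for bads of an opposite-free type set this is automatic).  Reason: the member of a
complemented bad is a co-member, so `M X \ M X'` is a certified co-good above the bad `X` whenever `X` is complemented OR
`X'` is plain; listing the complemented members of `D₂` before the plain ones, every "earlier minus later" difference is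
certified, which is all the ordered Marica–Schönheim mechanism needs (`ThreeFamilyRank.finrank_V_union`), and the rigidity
theorem TRIPLE⁻ never uses `Q \\ Q` (`ThreeFamilyRank.card_add_card_add_card_le_of_blocks_ordered`).

**Theorem (`card_le_card_goods_above_of_ordered_assignment`)**, SDR form `exists_injective_good_above_of_ordered_assignment`.
On four petals this raises the number of opposite-free type classes with a certificate from 29 to 33 of 41 — all twelve
4-type classes and 6 of the 10 five-type classes; e.g. the transitive triangle with a pendant arc
`{(0,1),(0,2),(1,2),(3,0)}`: `(0,1) ↦ (D₁, cpl)`, `(0,2) ↦ (D₂, plain)`, `(3,0) ↦ (D₂, cpl)`, `(1,2) ↦ (D₃, cpl)`.  The four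
tournaments and four 5-type classes remain open (memo prim-ineq-gen-3/FINDINGS-gen11.md, lab11/census_k.py).
(prim-ineq-gen-3 gen 11, 2026-08-20.)
-/

namespace Summit.CriticalPhenomena.PercolationContinuityZ3.Theorems

namespace OrientedAntipodalHall

open Finset AntipodalStrongHarris AntipodalStrongHarris.Lab ThreeFamilyRank
open scoped FinsetFamily

variable {α : Type*} [DecidableEq α] {k : ℕ}

/-- **The oriented antipodal Hall count from a three-group assignment with an ordered middle group.**  As
`card_le_card_goods_above_of_assignment`, but in the middle group `D₂` the complementation bits may differ; instead a
complemented and a plain member of `D₂` must not carry the same oriented labels. -/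
theorem card_le_card_goods_above_of_ordered_assignment (S : Finset α) {f : Finset α → Lab k}
    (hf : ∀ ⦃X Y : Finset α⦄, X ⊆ Y → f X ≤ f Y) (D₁ D₂ D₃ : Finset (Finset α))
    (cpl : Finset α → Bool) (a b : Finset α → Fin k)
    (hlab : ∀ X ∈ D₁ ∪ D₂ ∪ D₃, X ⊆ S ∧ (cpl X = false → f X = petal (a X) ∧ f (S \ X) = petal (b X)) ∧
      (cpl X = true → f (S \ X) = petal (a X) ∧ f X = petal (b X)))
    (hW₁ : ∀ X ∈ D₁, ∀ X' ∈ D₁, cpl X = cpl X' ∧ a X ≠ b X' ∧ b X ≠ a X')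
    (hW₂ : ∀ X ∈ D₂, ∀ X' ∈ D₂, a X ≠ b X' ∧ b X ≠ a X' ∧
      (cpl X = true → cpl X' = false → ¬ (a X = a X' ∧ b X = b X')))
    (hW₃ : ∀ X ∈ D₃, ∀ X' ∈ D₃, cpl X = cpl X' ∧ a X ≠ b X' ∧ b X ≠ a X')
    (hC₁₂ : ∀ X ∈ D₁, ∀ Y ∈ D₂, a X ≠ a Y ∧ b X ≠ b Y ∧ (cpl X = true ∨ cpl Y = true) ∧ ¬ (a X = b Y ∧ a Y = b X))
    (hC₂₃ : ∀ Y ∈ D₂, ∀ Z ∈ D₃, a Y ≠ a Z ∧ b Y ≠ b Z ∧ (cpl Y = true ∨ cpl Z = true) ∧ ¬ (a Y = b Z ∧ a Z = b Y))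
    (hC₃₁ : ∀ Z ∈ D₃, ∀ X ∈ D₁, a Z ≠ a X ∧ b Z ≠ b X ∧ (cpl Z = true ∨ cpl X = true) ∧ ¬ (a Z = b X ∧ a X = b Z))
    (hDD₁ : ∀ X ∈ D₁, ∀ Y ∈ D₂, ∀ Z ∈ D₃,
      ¬ (a X = b Y ∧ b Y = b Z) ∧ ¬ (b X = a Y ∧ a Y = a Z) ∧ (cpl X = true ∨ cpl Y = false ∨ cpl Z = false))
    (hDD₃ : ∀ X ∈ D₁, ∀ Y ∈ D₂, ∀ Z ∈ D₃,
      ¬ (a Z = b X ∧ b X = b Y) ∧ ¬ (b Z = a X ∧ a X = a Y) ∧ (cpl Z = true ∨ cpl X = false ∨ cpl Y = false)) :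
    #D₁ + #D₂ + #D₃ ≤
      #{U ∈ S.powerset | f U = top ∧ f (S \ U) = bot ∧ ∃ X ∈ D₁ ∪ D₂ ∪ D₃, X ⊆ U} := by
  -- the member of a bad
  set M : Finset α → Finset α := fun X => if cpl X = true then S \ X else X with hMdef
  have mem₁ : ∀ X ∈ D₁, X ∈ D₁ ∪ D₂ ∪ D₃ := fun X hX => mem_union_left _ (mem_union_left _ hX)
  have mem₂ : ∀ Y ∈ D₂, Y ∈ D₁ ∪ D₂ ∪ D₃ := fun Y hY => mem_union_left _ (mem_union_right _ hY)
  have mem₃ : ∀ Z ∈ D₃, Z ∈ D₁ ∪ D₂ ∪ D₃ := fun Z hZ => mem_union_right _ hZ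
  have hXS : ∀ X ∈ D₁ ∪ D₂ ∪ D₃, X ⊆ S := fun X hX => (hlab X hX).1
  have hMS : ∀ X ∈ D₁ ∪ D₂ ∪ D₃, M X ⊆ S := by
    intro X hX
    simp only [hMdef]
    split_ifs
    · exact sdiff_subset
    · exact hXS X hX
  have hMa : ∀ X ∈ D₁ ∪ D₂ ∪ D₃, f (M X) = petal (a X) := by
    intro X hX
    simp only [hMdef]
    by_cases hc : cpl X = true
    · rw [if_pos hc]; exact ((hlab X hX).2.2 hc).1
    · rw [if_neg hc]; exact ((hlab X hX).2.1 (by simpa using hc)).1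
  have hMb : ∀ X ∈ D₁ ∪ D₂ ∪ D₃, f (S \ M X) = petal (b X) := by
    intro X hX
    simp only [hMdef]
    by_cases hc : cpl X = true
    · rw [if_pos hc, Finset.sdiff_sdiff_eq_self (hXS X hX)]; exact ((hlab X hX).2.2 hc).2
    · rw [if_neg hc]; exact ((hlab X hX).2.1 (by simpa using hc)).2
  -- equal labels of nested members
  have hlabel_of_subset : ∀ X ∈ D₁ ∪ D₂ ∪ D₃, ∀ X' ∈ D₁ ∪ D₂ ∪ D₃, M X ⊆ M X' → a X = a X' ∧ b X = b X' := by
    intro X hX X' hX' hsub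
    constructor
    · exact eq_of_petal_le_petal (by rw [← hMa X hX, ← hMa X' hX']; exact hf hsub)
    · exact (eq_of_petal_le_petal (by
        rw [← hMb X' hX', ← hMb X hX]; exact hf (sdiff_subset_sdiff le_rfl hsub))).symm
  -- the bad witnessed by a member
  have below : ∀ {X F : Finset α}, X ⊆ S → F ⊆ S \ X → X ⊆ S \ F :=
    fun hXS hF => subset_sdiff_of_subset_sdiff' hXS hF
  have badM : ∀ X ∈ D₁ ∪ D₂ ∪ D₃, cpl X = true → ∀ {F : Finset α}, F ⊆ M X → X ⊆ S \ F := by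
    intro X hX hc F hF
    simp only [hMdef, if_pos hc] at hF
    exact below (hXS X hX) hF
  have badM' : ∀ X ∈ D₁ ∪ D₂ ∪ D₃, cpl X = false → ∀ {F : Finset α}, F ⊆ S \ M X → X ⊆ S \ F := by
    intro X hX hc F hF
    have hc' : ¬ cpl X = true := by simp [hc]
    simp only [hMdef, if_neg hc'] at hF
    exact below (hXS X hX) hF
  -- the co-goods above a bad
  set 𝒢 : Finset (Finset α) :=
    {F ∈ S.powerset | f (S \ F) = top ∧ f F = bot ∧ ∃ X ∈ D₁ ∪ D₂ ∪ D₃, X ⊆ S \ F} with h𝒢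
  have h𝒢S : ∀ E ∈ 𝒢, E ⊆ S := fun E hE => by
    rw [h𝒢, mem_filter, mem_powerset] at hE; exact hE.1
  have h𝒢down : ∀ E ∈ 𝒢, ∀ F, F ⊆ E → F ∈ 𝒢 := by
    intro E hE F hFE
    rw [h𝒢, mem_filter, mem_powerset] at hE ⊢
    obtain ⟨hES, htop, hbot, X, hX, hXE⟩ := hE
    refine ⟨hFE.trans hES, eq_top_of_top_le ?_, eq_bot_of_le_bot ?_, X, hX,
      hXE.trans (sdiff_subset_sdiff le_rfl hFE)⟩
    · rw [← htop]; exact hf (sdiff_subset_sdiff le_rfl hFE)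
    · rw [← hbot]; exact hf hFE
  -- certification with two witnesses on each side
  have cert : ∀ {F U₁ U₂ V₁ V₂ : Finset α} {p q r s : Fin k}, F ⊆ S → p ≠ q → r ≠ s →
      f U₁ = petal p → f U₂ = petal q → U₁ ⊆ S \ F → U₂ ⊆ S \ F →
      f V₁ = petal r → f V₂ = petal s → F ⊆ V₁ → F ⊆ V₂ →
      (∃ X ∈ D₁ ∪ D₂ ∪ D₃, X ⊆ S \ F) → F ∈ 𝒢 := by
    intro F U₁ U₂ V₁ V₂ p q r s hFS hpq hrs hU₁ hU₂ h₁ h₂ hV₁ hV₂ h₃ h₄ hX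
    obtain ⟨htop, hbot⟩ := good_sdiff_of_witnesses S hf hFS hpq hrs hU₁ hU₂ h₁ h₂ hV₁ hV₂ h₃ h₄
    rw [Finset.sdiff_sdiff_eq_self hFS] at hbot
    rw [h𝒢, mem_filter, mem_powerset]
    exact ⟨hFS, htop, hbot, hX⟩
  -- certification with three witnesses on each side
  have cert₃ : ∀ {F U₁ U₂ U₃ V₁ V₂ V₃ : Finset α} {p q r x y z : Fin k}, F ⊆ S → ¬ (p = q ∧ q = r) →
      ¬ (x = y ∧ y = z) → f U₁ = petal p → f U₂ = petal q → f U₃ = petal r →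
      U₁ ⊆ S \ F → U₂ ⊆ S \ F → U₃ ⊆ S \ F →
      f V₁ = petal x → f V₂ = petal y → f V₃ = petal z → F ⊆ V₁ → F ⊆ V₂ → F ⊆ V₃ →
      (∃ X ∈ D₁ ∪ D₂ ∪ D₃, X ⊆ S \ F) → F ∈ 𝒢 := by
    intro F U₁ U₂ U₃ V₁ V₂ V₃ p q r x y z hFS hpqr hxyz hU₁ hU₂ hU₃ h₁ h₂ h₃ hV₁ hV₂ hV₃ h₄ h₅ h₆ hX
    rw [h𝒢, mem_filter, mem_powerset]
    refine ⟨hFS, ?_, ?_, hX⟩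
    · exact eq_top_of_three_le hpqr (by rw [← hU₁]; exact hf h₁) (by rw [← hU₂]; exact hf h₂)
        (by rw [← hU₃]; exact hf h₃)
    · exact eq_bot_of_le_three hxyz (by rw [← hV₁]; exact hf h₄) (by rw [← hV₂]; exact hf h₅)
        (by rw [← hV₃]; exact hf h₆)
  -- a single ordered difference `M X \ M X'`: certified when `X` is complemented or `X'` is plain
  have hdiff : ∀ X ∈ D₁ ∪ D₂ ∪ D₃, ∀ X' ∈ D₁ ∪ D₂ ∪ D₃, a X ≠ b X' → b X ≠ a X' →
      (cpl X = true ∨ cpl X' = false) → M X \ M X' ∈ 𝒢 := by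
    intro X hX X' hX' hab hba hc
    have hFS : M X \ M X' ⊆ S := sdiff_subset.trans (hMS X hX)
    have hF1 : M X \ M X' ⊆ M X := sdiff_subset
    have hF2 : M X \ M X' ⊆ S \ M X' := sdiff_subset_sdiff (hMS X hX) le_rfl
    have hbad : ∃ X₀ ∈ D₁ ∪ D₂ ∪ D₃, X₀ ⊆ S \ (M X \ M X') := by
      rcases hc with hc | hc
      · exact ⟨X, hX, badM X hX hc hF1⟩
      · exact ⟨X', hX', badM' X' hX' hc hF2⟩
    exact cert hFS hba hab (hMb X hX) (hMa X' hX') (sdiff_subset_sdiff le_rfl hF1)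
      (below (hMS X' hX') hF2) (hMa X hX) (hMb X' hX') hF1 hF2 hbad
  -- within-group differences for groups with equal bits
  have hWblock : ∀ D : Finset (Finset α), (∀ X ∈ D, X ∈ D₁ ∪ D₂ ∪ D₃) →
      (∀ X ∈ D, ∀ X' ∈ D, cpl X = cpl X' ∧ a X ≠ b X' ∧ b X ≠ a X') →
      ∀ U ∈ D.image M, ∀ U' ∈ D.image M, U \ U' ∈ 𝒢 := by
    intro D hD hW U hU U' hU'
    obtain ⟨X, hX, rfl⟩ := mem_image.mp hU
    obtain ⟨X', hX', rfl⟩ := mem_image.mp hU'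
    obtain ⟨hcc, hab, hba⟩ := hW X hX X' hX'
    refine hdiff X (hD X hX) X' (hD X' hX') hab hba ?_
    by_cases hc : cpl X = true
    · exact Or.inl hc
    · right; rw [← hcc]; simpa using hc
  -- cross meets
  have hCblock : ∀ Dₛ Dₜ : Finset (Finset α), (∀ X ∈ Dₛ, X ∈ D₁ ∪ D₂ ∪ D₃) → (∀ Y ∈ Dₜ, Y ∈ D₁ ∪ D₂ ∪ D₃) →
      (∀ X ∈ Dₛ, ∀ Y ∈ Dₜ, a X ≠ a Y ∧ b X ≠ b Y ∧ (cpl X = true ∨ cpl Y = true) ∧ ¬ (a X = b Y ∧ a Y = b X)) →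
      ∀ U ∈ Dₛ.image M, ∀ U' ∈ Dₜ.image M, U ∩ U' ∈ 𝒢 ∧ (U ∩ U').Nonempty := by
    intro Dₛ Dₜ hDₛ hDₜ hC U hU U' hU'
    obtain ⟨X, hX, rfl⟩ := mem_image.mp hU
    obtain ⟨Y, hY, rfl⟩ := mem_image.mp hU'
    obtain ⟨haa, hbb, hcpl, hnopp⟩ := hC X hX Y hY
    have hX3 := hDₛ X hX
    have hY3 := hDₜ Y hY
    have hF1 : M X ∩ M Y ⊆ M X := inter_subset_left
    have hF2 : M X ∩ M Y ⊆ M Y := inter_subset_right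
    have hFS : M X ∩ M Y ⊆ S := hF1.trans (hMS X hX3)
    have hbad : ∃ X₀ ∈ D₁ ∪ D₂ ∪ D₃, X₀ ⊆ S \ (M X ∩ M Y) := by
      rcases hcpl with hc | hc
      · exact ⟨X, hX3, badM X hX3 hc hF1⟩
      · exact ⟨Y, hY3, badM Y hY3 hc hF2⟩
    refine ⟨cert hFS hbb haa (hMb X hX3) (hMb Y hY3) (sdiff_subset_sdiff le_rfl hF1)
      (sdiff_subset_sdiff le_rfl hF2) (hMa X hX3) (hMa Y hY3) hF1 hF2 hbad, ?_⟩
    rw [nonempty_iff_ne_empty]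
    intro he
    apply hnopp
    constructor
    · have hsub : M X ⊆ S \ M Y := by
        intro x hx
        refine mem_sdiff.mpr ⟨hMS X hX3 hx, fun hxY => ?_⟩
        have : x ∈ M X ∩ M Y := mem_inter.mpr ⟨hx, hxY⟩
        rw [he] at this
        simp at this
      exact eq_of_petal_le_petal (by rw [← hMa X hX3, ← hMb Y hY3]; exact hf hsub)
    · have hsub : M Y ⊆ S \ M X := by
        intro y hy
        refine mem_sdiff.mpr ⟨hMS Y hY3 hy, fun hyX => ?_⟩
        have : y ∈ M X ∩ M Y := mem_inter.mpr ⟨hyX, hy⟩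
        rw [he] at this
        simp at this
      exact eq_of_petal_le_petal (by rw [← hMa Y hY3, ← hMb X hX3]; exact hf hsub)
  -- unpacking a double difference inside `S`
  have dd_sub : ∀ {A B C : Finset α}, A ⊆ S →
      A \ (B ∪ C) ⊆ A ∧ A \ (B ∪ C) ⊆ S \ B ∧ A \ (B ∪ C) ⊆ S \ C := by
    intro A B C hAS
    refine ⟨sdiff_subset, fun x hx => ?_, fun x hx => ?_⟩
    · have hx' := mem_sdiff.mp hx
      exact mem_sdiff.mpr ⟨hAS hx'.1, fun hxB => hx'.2 (mem_union_left _ hxB)⟩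
    · have hx' := mem_sdiff.mp hx
      exact mem_sdiff.mpr ⟨hAS hx'.1, fun hxC => hx'.2 (mem_union_right _ hxC)⟩
  -- the two outer double differences
  have hDDPblock : ∀ U ∈ D₁.image M, ∀ U' ∈ D₂.image M, ∀ U'' ∈ D₃.image M, U \ (U' ∪ U'') ∈ 𝒢 := by
    intro U hU U' hU' U'' hU''
    obtain ⟨X, hX, rfl⟩ := mem_image.mp hU
    obtain ⟨Y, hY, rfl⟩ := mem_image.mp hU'
    obtain ⟨Z, hZ, rfl⟩ := mem_image.mp hU''
    obtain ⟨h1, h2, h3⟩ := hDD₁ X hX Y hY Z hZ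
    have hX3 := mem₁ X hX; have hY3 := mem₂ Y hY; have hZ3 := mem₃ Z hZ
    obtain ⟨hFX, hFY, hFZ⟩ := dd_sub (B := M Y) (C := M Z) (hMS X hX3)
    have hFS : M X \ (M Y ∪ M Z) ⊆ S := hFX.trans (hMS X hX3)
    have hbad : ∃ X₀ ∈ D₁ ∪ D₂ ∪ D₃, X₀ ⊆ S \ (M X \ (M Y ∪ M Z)) := by
      rcases h3 with hc | hc | hc
      · exact ⟨X, hX3, badM X hX3 hc hFX⟩
      · exact ⟨Y, hY3, badM' Y hY3 hc hFY⟩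
      · exact ⟨Z, hZ3, badM' Z hZ3 hc hFZ⟩
    have h2' : ¬ (b X = a Y ∧ a Y = a Z) := h2
    exact cert₃ hFS h2' h1 (hMb X hX3) (hMa Y hY3) (hMa Z hZ3) (sdiff_subset_sdiff le_rfl hFX)
      (below (hMS Y hY3) hFY) (below (hMS Z hZ3) hFZ) (hMa X hX3) (hMb Y hY3) (hMb Z hZ3) hFX hFY hFZ hbad
  have hDDRblock : ∀ U ∈ D₁.image M, ∀ U' ∈ D₂.image M, ∀ U'' ∈ D₃.image M, U'' \ (U ∪ U') ∈ 𝒢 := by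
    intro U hU U' hU' U'' hU''
    obtain ⟨X, hX, rfl⟩ := mem_image.mp hU
    obtain ⟨Y, hY, rfl⟩ := mem_image.mp hU'
    obtain ⟨Z, hZ, rfl⟩ := mem_image.mp hU''
    obtain ⟨h1, h2, h3⟩ := hDD₃ X hX Y hY Z hZ
    have hX3 := mem₁ X hX; have hY3 := mem₂ Y hY; have hZ3 := mem₃ Z hZ
    obtain ⟨hFZ, hFX, hFY⟩ := dd_sub (B := M X) (C := M Y) (hMS Z hZ3)
    have hFS : M Z \ (M X ∪ M Y) ⊆ S := hFZ.trans (hMS Z hZ3)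
    have hbad : ∃ X₀ ∈ D₁ ∪ D₂ ∪ D₃, X₀ ⊆ S \ (M Z \ (M X ∪ M Y)) := by
      rcases h3 with hc | hc | hc
      · exact ⟨Z, hZ3, badM Z hZ3 hc hFZ⟩
      · exact ⟨X, hX3, badM' X hX3 hc hFX⟩
      · exact ⟨Y, hY3, badM' Y hY3 hc hFY⟩
    exact cert₃ hFS h2 h1 (hMb Z hZ3) (hMa X hX3) (hMa Y hY3) (sdiff_subset_sdiff le_rfl hFZ)
      (below (hMS X hX3) hFX) (below (hMS Y hY3) hFY) (hMa Z hZ3) (hMb X hX3) (hMb Y hY3) hFZ hFX hFY hbad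
  -- the member families; the middle one split by the complementation bit (complemented members first)
  set P : Finset (Finset α) := D₁.image M with hPdef
  set R : Finset (Finset α) := D₃.image M with hRdef
  set D₂c : Finset (Finset α) := D₂.filter (fun X => cpl X = true) with hD₂c
  set D₂p : Finset (Finset α) := D₂.filter (fun X => cpl X = false) with hD₂p
  set Q₁ : Finset (Finset α) := D₂c.image M with hQ₁def
  set Q₂ : Finset (Finset α) := D₂p.image M with hQ₂def
  have hD₂c_sub : ∀ X ∈ D₂c, X ∈ D₂ := fun X hX => (mem_filter.mp hX).1
  have hD₂p_sub : ∀ X ∈ D₂p, X ∈ D₂ := fun X hX => (mem_filter.mp hX).1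
  have hD₂split : D₂ = D₂c ∪ D₂p := by
    ext X
    simp only [hD₂c, hD₂p, mem_union, mem_filter]
    constructor
    · intro hX
      by_cases hc : cpl X = true
      · exact Or.inl ⟨hX, hc⟩
      · exact Or.inr ⟨hX, by simpa using hc⟩
    · rintro (⟨hX, -⟩ | ⟨hX, -⟩) <;> exact hX
  have hQeq : D₂.image M = Q₁ ∪ Q₂ := by
    rw [hQ₁def, hQ₂def, ← image_union, ← hD₂split]
  have hQ₁₁ : ∀ U ∈ Q₁, ∀ U' ∈ Q₁, U \ U' ∈ 𝒢 :=
    hWblock D₂c (fun X hX => mem₂ X (hD₂c_sub X hX)) (fun X hX X' hX' => by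
      obtain ⟨hab, hba, -⟩ := hW₂ X (hD₂c_sub X hX) X' (hD₂c_sub X' hX')
      exact ⟨by rw [(mem_filter.mp hX).2, (mem_filter.mp hX').2], hab, hba⟩)
  have hQ₂₂ : ∀ U ∈ Q₂, ∀ U' ∈ Q₂, U \ U' ∈ 𝒢 :=
    hWblock D₂p (fun X hX => mem₂ X (hD₂p_sub X hX)) (fun X hX X' hX' => by
      obtain ⟨hab, hba, -⟩ := hW₂ X (hD₂p_sub X hX) X' (hD₂p_sub X' hX')
      exact ⟨by rw [(mem_filter.mp hX).2, (mem_filter.mp hX').2], hab, hba⟩)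
  have hQ₁₂ : ∀ U ∈ Q₁, ∀ U' ∈ Q₂, U \ U' ∈ 𝒢 ∧ ¬ U ⊆ U' := by
    intro U hU U' hU'
    obtain ⟨X, hX, rfl⟩ := mem_image.mp hU
    obtain ⟨X', hX', rfl⟩ := mem_image.mp hU'
    have hc : cpl X = true := (mem_filter.mp hX).2
    have hc' : cpl X' = false := (mem_filter.mp hX').2
    have hX2 := hD₂c_sub X hX; have hX'2 := hD₂p_sub X' hX'
    obtain ⟨hab, hba, hne⟩ := hW₂ X hX2 X' hX'2
    exact ⟨hdiff X (mem₂ X hX2) X' (mem₂ X' hX'2) hab hba (Or.inl hc),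
      fun hsub => hne hc hc' (hlabel_of_subset X (mem₂ X hX2) X' (mem₂ X' hX'2) hsub)⟩
  -- cardinalities
  have hinjM : ∀ D : Finset (Finset α), (∀ X ∈ D, X ∈ D₁ ∪ D₂ ∪ D₃) →
      (∀ X ∈ D, ∀ X' ∈ D, cpl X = cpl X' ∧ a X ≠ b X' ∧ b X ≠ a X') → #(D.image M) = #D := by
    intro D hD hW
    apply card_image_of_injOn
    intro X hX X' hX' hXX'
    have hcc := (hW X hX X' hX').1
    simp only [hMdef] at hXX'
    by_cases hc : cpl X = true
    · have hc' : cpl X' = true := by rw [← hcc]; exact hc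
      rw [if_pos hc, if_pos hc'] at hXX'
      rw [← Finset.sdiff_sdiff_eq_self (hXS X (hD X hX)), ← Finset.sdiff_sdiff_eq_self (hXS X' (hD X' hX')), hXX']
    · have hc' : ¬ cpl X' = true := by rw [← hcc]; exact hc
      rw [if_neg hc, if_neg hc'] at hXX'
      exact hXX'
  have hcP : #P = #D₁ := hinjM D₁ mem₁ hW₁
  have hcR : #R = #D₃ := hinjM D₃ mem₃ hW₃
  have hcQ₁ : #Q₁ = #D₂c := hinjM D₂c (fun X hX => mem₂ X (hD₂c_sub X hX)) (fun X hX X' hX' => by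
      obtain ⟨hab, hba, -⟩ := hW₂ X (hD₂c_sub X hX) X' (hD₂c_sub X' hX')
      exact ⟨by rw [(mem_filter.mp hX).2, (mem_filter.mp hX').2], hab, hba⟩)
  have hcQ₂ : #Q₂ = #D₂p := hinjM D₂p (fun X hX => mem₂ X (hD₂p_sub X hX)) (fun X hX X' hX' => by
      obtain ⟨hab, hba, -⟩ := hW₂ X (hD₂p_sub X hX) X' (hD₂p_sub X' hX')
      exact ⟨by rw [(mem_filter.mp hX).2, (mem_filter.mp hX').2], hab, hba⟩)
  have hQdisj : Disjoint Q₁ Q₂ := by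
    rw [Finset.disjoint_left]
    intro U hU hU'
    exact (hQ₁₂ U hU U hU').2 le_rfl
  have hD₂disj : Disjoint D₂c D₂p := by
    rw [Finset.disjoint_left]
    intro X hX hX'
    have h1 : cpl X = true := (mem_filter.mp hX).2
    have h2 : cpl X = false := (mem_filter.mp hX').2
    rw [h1] at h2
    exact Bool.noConfusion h2
  have hcQ : #(Q₁ ∪ Q₂) = #D₂ := by
    rw [card_union_of_disjoint hQdisj, hcQ₁, hcQ₂, hD₂split, card_union_of_disjoint hD₂disj]
  have hfamS : ∀ D : Finset (Finset α), (∀ X ∈ D, X ∈ D₁ ∪ D₂ ∪ D₃) → ∀ U ∈ D.image M, U ⊆ S := by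
    intro D hD U hU
    obtain ⟨X, hX, rfl⟩ := mem_image.mp hU
    exact hMS X (hD X hX)
  have hQS : ∀ U ∈ Q₁ ∪ Q₂, U ⊆ S := fun U hU => hfamS D₂ mem₂ U (hQeq ▸ hU)
  have hdisj : ∀ U ∈ P, U ∉ R := by
    intro U hU hUR
    obtain ⟨X, hX, rfl⟩ := mem_image.mp hU
    obtain ⟨Z, hZ, hZX⟩ := mem_image.mp hUR
    have h1 := hMa X (mem₁ X hX)
    rw [← hZX, hMa Z (mem₃ Z hZ)] at h1
    exact (hC₃₁ Z hZ X hX).1 (Lab.petal.inj h1)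
  have hPQ' := hCblock D₁ D₂ mem₁ mem₂ hC₁₂
  have hQR' := hCblock D₂ D₃ mem₂ mem₃ hC₂₃
  have hcount := card_add_card_add_card_le_of_blocks_ordered S 𝒢 P Q₁ Q₂ R h𝒢S h𝒢down (hfamS D₁ mem₁) hQS
    (hfamS D₃ mem₃) (hWblock D₁ mem₁ hW₁) hQ₁₁ hQ₂₂ hQ₁₂ (hWblock D₃ mem₃ hW₃)
    (fun X hX Y hY => hPQ' X hX Y (hQeq ▸ hY)) (fun Y hY Z hZ => hQR' Y (hQeq ▸ hY) Z hZ)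
    (hCblock D₃ D₁ mem₃ mem₁ hC₃₁)
    (fun X hX Y hY Z hZ => hDDPblock X hX Y (hQeq ▸ hY) Z hZ)
    (fun X hX Y hY Z hZ => hDDRblock X hX Y (hQeq ▸ hY) Z hZ) hdisj
  -- complementation is injective on `𝒢` and lands in the goods above a bad
  have hinj𝒢 : Set.InjOn (fun F => S \ F) (𝒢 : Set (Finset α)) := by
    intro F₁ hF₁ F₂ hF₂ h
    have e₁ := Finset.sdiff_sdiff_eq_self (h𝒢S F₁ hF₁)
    have e₂ := Finset.sdiff_sdiff_eq_self (h𝒢S F₂ hF₂)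
    simp only at h
    rw [← e₁, ← e₂, h]
  have himg : 𝒢.image (fun F => S \ F) ⊆
      {U ∈ S.powerset | f U = top ∧ f (S \ U) = bot ∧ ∃ X ∈ D₁ ∪ D₂ ∪ D₃, X ⊆ U} := by
    intro U hU
    obtain ⟨F, hF, rfl⟩ := mem_image.mp hU
    rw [h𝒢, mem_filter, mem_powerset] at hF
    obtain ⟨hFS, htop, hbot, X, hX, hXF⟩ := hF
    rw [mem_filter, mem_powerset]
    refine ⟨sdiff_subset, htop, ?_, X, hX, hXF⟩
    rw [Finset.sdiff_sdiff_eq_self hFS]; exact hbot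
  calc #D₁ + #D₂ + #D₃ = #P + #(Q₁ ∪ Q₂) + #R := by rw [hcP, hcQ, hcR]
    _ ≤ #𝒢 := hcount
    _ = #(𝒢.image fun F => S \ F) := (card_image_of_injOn hinj𝒢).symm
    _ ≤ _ := card_le_card himg

end OrientedAntipodalHall

end Summit.CriticalPhenomena.PercolationContinuityZ3.Theorems
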